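import Summits.ResolutionOfSingularities.ResolutionOfSingularities.Theorems.PurelyInseparableDim4JointHereditaryCertComputations
import Summits.ResolutionOfSingularities.ResolutionOfSingularities.Theorems.Rescue.BedMohRiseQ4TopLocus
import Summits.ResolutionOfSingularities.ResolutionOfSingularities.Theorems.Rescue.BedSlopeResidualWQAxis
import HarnessLib

/-!
# Purely inseparable four-folds: chart analyses for the HEREDITARY-WAITING certificate — equimultiple points and dead charts of
# `F₁`, `G₀, G₁, G₂`, `H₀, H₁, H₃` (brick S3 (c) «joint point∘coordinate chains», part 67b; cell `res-dim4-pi`)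

[OURS · counted 0] (D-0157 DOOR 2; host item stmt-ResolutionOfSingularities-16155, helper). Nothing here proves resolution of
singularities in dimension ≥ 4 / characteristic `p`. Model-level case analyses for part 67 (`p ≥ 3`): on the root's `x₁`-chart the
equimultiple pairs `(x₁, b)` have `b₂ = 0` (`∂₁`) and `b₃ b₄ = 0` (the coefficient of `y₂^{p−1}` of `F₁(y + b)` is `b₃ b₄` — a degree
`p − 1` Taylor coefficient, read off `WeightedBlowup.coeff_translate_monomial`); the `x₂`-chart is dead (linear `y₂`); the child entry
`(x₁, 0, {y₁,y₂,y₃})` is equimultiple and its state is `F₁`; the child's charts `y₁`, `y₂` are dead and on `y₃` the only normalised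
equimultiple pair is the origin (coefficient `b₄` of `w₂^{p−1}`), covered by the hereditary entry `(y₃, 0, {y₁,y₂,y₄})` whose kid state is
`G₂`; the kid's three charts are dead.

* `coeff_translate_four` (Taylor coefficients of a translated four-exponent monomial); the lemmas listed above.

AI-produced formalisation, weaker than expert review. bears_on: LADDER-RESOLUTION:D157-DOOR2 (res-dim4-pi · S3 (c) v3-H certificate · charts).
-/

set_option linter.dupNamespace false -- D-0017: single-problem summit path `Summit.<S>.<S>.…` by design

noncomputable section

open MvPolynomial Finset

namespace Summit.ResolutionOfSingularities.ResolutionOfSingularities.Theorems.PIDim4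

open Literature.AlgebraicGeometry.Resolution
open Literature.AlgebraicGeometry.Resolution.Hauser2010

namespace Equimultiple

section HCertCharts

variable {K : Type} [Field K] {p : ℕ} [hp : Fact p.Prime] [CharP K p]

/-! ## §1 Taylor coefficients of four-exponent monomials -/

omit hp [CharP K p] in
/-- **Taylor coefficient of a translated four-exponent monomial.** [cite: EGAIV4, Thm. 16.11.2 (16.11.2.1)] -/
theorem coeff_translate_four (b : Fin 4 → K) (r : K) (e₀ e₁ e₂ e₃ d₀ d₁ d₂ d₃ : ℕ) :
    coeff (Finsupp.single 0 d₀ + Finsupp.single 1 d₁ + Finsupp.single 2 d₂ + Finsupp.single 3 d₃)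
        (PointBlowup.translate b (C r * (X 0 ^ e₀ * X 1 ^ e₁ * X 2 ^ e₂ * X 3 ^ e₃) : MvPolynomial (Fin 4) K)) =
      r * (((e₀.choose d₀ : K) * b 0 ^ (e₀ - d₀)) * ((e₁.choose d₁ : K) * b 1 ^ (e₁ - d₁)) *
        ((e₂.choose d₂ : K) * b 2 ^ (e₂ - d₂)) * ((e₃.choose d₃ : K) * b 3 ^ (e₃ - d₃))) := by
  rw [C_mul_X_pow_four, WeightedBlowup.coeff_translate_monomial, Fin.prod_univ_four]
  simp

/-! ## §2 The root's charts -/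

omit [CharP K p] in
/-- **The child entry is equimultiple**: at `b = 0` every monomial of `F₁` has degree `≥ p`. [cite: Hauser2010, §F (equiconstant points)] -/
theorem isEquimultiplePoint_S0_zero_hcert [DecidableEq K] (hp3 : 3 ≤ p) (s : State K)
    (hs : s.F = X 0 * X 1 ^ (p - 1) * X 2 * X 3 + X 0 ^ (2 * p - 2) * X 1 + X 1 ^ (p + 1)) :
    CentreBlowup.IsEquimultiplePoint p ({0, 1} : Finset (Fin 4)) 0 (0 : Fin 4 → K) s := by
  intro d hd0 hdeg
  unfold CentreBlowup.pointTransform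
  rw [hs, chartTransform_S0_hcert, PointBlowup.translate_zero]
  by_contra hne
  rcases mem_support_three (mem_support_iff.mpr hne) with rfl | rfl | rfl <;> rw [Rescue.BedSlopeResidual.degree_E4] at hdeg <;> omega

omit [CharP K p] in
/-- **Chart `x₁`: the equimultiple pairs lie on the cross** — `b₂ = 0` (the coefficient of `y₁` is `b₂^{p+1}`) and `b₃ b₄ = 0`
(the coefficient of `y₂^{p−1}` is `b₃ b₄`). [cite: Hauser2010, §F (equiconstant points)] -/
theorem cases_S0_hcert [DecidableEq K] (hp3 : 3 ≤ p) {b : Fin 4 → K} (s : State K)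
    (hs : s.F = X 0 * X 1 ^ (p - 1) * X 2 * X 3 + X 0 ^ (2 * p - 2) * X 1 + X 1 ^ (p + 1))
    (h : CentreBlowup.IsEquimultiplePoint p ({0, 1} : Finset (Fin 4)) 0 b s) (hb : b 0 = 0) : b 1 = 0 ∧ (b 2 = 0 ∨ b 3 = 0) := by
  have hp0 : p ≠ 0 := hp.out.ne_zero
  unfold CentreBlowup.IsEquimultiplePoint CentreBlowup.pointTransform at h
  rw [hs, chartTransform_S0_hcert] at h
  have h0 := eval_pderiv_eq_zero_of_forall_coeff b _ h 0
  simp [(pderiv (0 : Fin 4)).leibniz_pow, hb, zero_pow (show p - 1 - 1 ≠ 0 by omega)] at h0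
  have hb1 : b 1 = 0 := h0
  refine ⟨hb1, ?_⟩
  have hc := h (Finsupp.single 0 0 + Finsupp.single 1 (p - 1) + Finsupp.single 2 0 + Finsupp.single 3 0)
    (fun he => by have := DFunLike.congr_fun he 1; simp at this; omega) (by rw [Rescue.BedSlopeResidual.degree_E4]; omega)
  rw [Rescue.BedMohRiseQ4TopLocus.translate_add, Rescue.BedMohRiseQ4TopLocus.translate_add, coeff_add, coeff_add, coeff_translate_four, coeff_translate_four, coeff_translate_four,
    hb, hb1, Nat.choose_eq_zero_of_lt (show 1 < p - 1 by omega)] at hc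
  simp at hc
  exact hc

omit [CharP K p] in
/-- **Chart `x₂` is DEAD**: on the divisor (`b₂ = 0`) the coefficient of `y₂` is `1`. [cite: Hauser2010, §F (equiconstant points)] -/
theorem not_isEquimultiplePoint_S1_hcert [DecidableEq K] (hp3 : 3 ≤ p) {b : Fin 4 → K} (s : State K)
    (hs : s.F = X 0 * X 1 ^ (p - 1) * X 2 * X 3 + X 0 ^ (2 * p - 2) * X 1 + X 1 ^ (p + 1)) (hb : b 1 = 0) :
    ¬ CentreBlowup.IsEquimultiplePoint p ({0, 1} : Finset (Fin 4)) 1 b s := by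
  intro h
  unfold CentreBlowup.IsEquimultiplePoint CentreBlowup.pointTransform at h
  rw [hs, chartTransform_S1_hcert] at h
  have h1 := eval_pderiv_eq_zero_of_forall_coeff b _ h 1
  simp [(pderiv (1 : Fin 4)).leibniz_pow, hb, zero_pow (show p - 1 - 1 ≠ 0 by omega)] at h1

omit [CharP K p] in
/-- **The child's state is `F₁`** (already clean). [cite: HauserPerlega2019PRIMS, §2 (cleaning)] -/
theorem step_S0_hcert [DecidableEq K] (hp3 : 3 ≤ p) (s : State K)
    (hs : s.F = X 0 * X 1 ^ (p - 1) * X 2 * X 3 + X 0 ^ (2 * p - 2) * X 1 + X 1 ^ (p + 1)) :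
    (CentreBlowup.step p ({0, 1} : Finset (Fin 4)) 0 (0 : Fin 4 → K) s).F =
      C 1 * (X 0 ^ 0 * X 1 ^ (p - 1) * X 2 ^ 1 * X 3 ^ 1) + C 1 * (X 0 ^ (p - 1) * X 1 ^ 1 * X 2 ^ 0 * X 3 ^ 0) +
        C 1 * (X 0 ^ 1 * X 1 ^ (p + 1) * X 2 ^ 0 * X 3 ^ 0) := by
  show deletePthPowers p (PointBlowup.translate (0 : Fin 4 → K)
    (CentreBlowup.chartTransform p ({0, 1} : Finset (Fin 4)) 0 s.F)) = _
  rw [hs, chartTransform_S0_hcert, PointBlowup.translate_zero]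
  exact Literature.Barriers.ResolutionOfSingularities.HauserPerlega.deletePthPowers_eq_self (isClean_F1_hcert hp3)

/-! ## §3 The child's charts -/

omit [CharP K p] in
/-- **Child chart `y₁` is DEAD**: `∂₃ G₀ = u₂^{p−1} u₄`, `∂₂ G₀ = 1 − u₂^{p−2} u₃ u₄ + …`. [cite: Hauser2010, §F (equiconstant points)] -/
theorem not_isEquimultiplePoint_U0_hcert [DecidableEq K] (hp3 : 3 ≤ p) {b : Fin 4 → K} (s : State K)
    (hs : s.F = C 1 * (X 0 ^ 0 * X 1 ^ (p - 1) * X 2 ^ 1 * X 3 ^ 1) + C 1 * (X 0 ^ (p - 1) * X 1 ^ 1 * X 2 ^ 0 * X 3 ^ 0) +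
        C 1 * (X 0 ^ 1 * X 1 ^ (p + 1) * X 2 ^ 0 * X 3 ^ 0)) (hb : b 0 = 0) :
    ¬ CentreBlowup.IsEquimultiplePoint p ({0, 1, 2} : Finset (Fin 4)) 0 b s := by
  intro h
  unfold CentreBlowup.IsEquimultiplePoint CentreBlowup.pointTransform at h
  rw [hs, chartTransform_U0_hcert] at h
  have h1 := eval_pderiv_eq_zero_of_forall_coeff b _ h 1
  have h2 := eval_pderiv_eq_zero_of_forall_coeff b _ h 2
  simp [(pderiv (1 : Fin 4)).leibniz_pow, (pderiv (2 : Fin 4)).leibniz_pow, hb] at h1 h2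
  have key : b 3 * (b 2 * ((p - 1 : ℕ) * b 1 ^ (p - 1 - 1))) = 0 := by
    rcases h2 with h2 | ⟨h2, -⟩
    · rw [h2, zero_mul]
    · rw [h2, zero_pow (by omega), mul_zero, mul_zero, mul_zero]
  rw [key, zero_add] at h1
  exact one_ne_zero h1

omit [CharP K p] in
/-- **Child chart `y₂` is DEAD**: the coefficient of `v₃ v₄` is `1`. [cite: Hauser2010, §F (equiconstant points)] -/
theorem not_isEquimultiplePoint_U1_hcert [DecidableEq K] (hp3 : 3 ≤ p) {b : Fin 4 → K} (s : State K)
    (hs : s.F = C 1 * (X 0 ^ 0 * X 1 ^ (p - 1) * X 2 ^ 1 * X 3 ^ 1) + C 1 * (X 0 ^ (p - 1) * X 1 ^ 1 * X 2 ^ 0 * X 3 ^ 0) +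
        C 1 * (X 0 ^ 1 * X 1 ^ (p + 1) * X 2 ^ 0 * X 3 ^ 0)) :
    ¬ CentreBlowup.IsEquimultiplePoint p ({0, 1, 2} : Finset (Fin 4)) 1 b s := by
  intro h
  unfold CentreBlowup.IsEquimultiplePoint CentreBlowup.pointTransform at h
  rw [hs, chartTransform_U1_hcert] at h
  have hc := h (Finsupp.single 0 0 + Finsupp.single 1 0 + Finsupp.single 2 1 + Finsupp.single 3 1)
    (fun he => by have := DFunLike.congr_fun he 2; simp at this) (by rw [Rescue.BedSlopeResidual.degree_E4]; omega)
  rw [Rescue.BedMohRiseQ4TopLocus.translate_add, Rescue.BedMohRiseQ4TopLocus.translate_add, coeff_add, coeff_add, coeff_translate_four, coeff_translate_four, coeff_translate_four] at hc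
  simp at hc

omit [CharP K p] in
/-- **Child chart `y₃`: a normalised equimultiple pair is the origin** (the coefficient of `w₂^{p−1}` is `b₄`).
[cite: Hauser2010, §F (equiconstant points)] -/
theorem cases_U2_hcert [DecidableEq K] (hp3 : 3 ≤ p) {b : Fin 4 → K} (s : State K)
    (hs : s.F = C 1 * (X 0 ^ 0 * X 1 ^ (p - 1) * X 2 ^ 1 * X 3 ^ 1) + C 1 * (X 0 ^ (p - 1) * X 1 ^ 1 * X 2 ^ 0 * X 3 ^ 0) +
        C 1 * (X 0 ^ 1 * X 1 ^ (p + 1) * X 2 ^ 0 * X 3 ^ 0))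
    (h : CentreBlowup.IsEquimultiplePoint p ({0, 1, 2} : Finset (Fin 4)) 2 b s) (hb0 : b 0 = 0) : b 3 = 0 := by
  unfold CentreBlowup.IsEquimultiplePoint CentreBlowup.pointTransform at h
  rw [hs, chartTransform_U2_hcert] at h
  have hc := h (Finsupp.single 0 0 + Finsupp.single 1 (p - 1) + Finsupp.single 2 0 + Finsupp.single 3 0)
    (fun he => by have := DFunLike.congr_fun he 1; simp at this; omega) (by rw [Rescue.BedSlopeResidual.degree_E4]; omega)
  rw [Rescue.BedMohRiseQ4TopLocus.translate_add, Rescue.BedMohRiseQ4TopLocus.translate_add, coeff_add, coeff_add, coeff_translate_four, coeff_translate_four, coeff_translate_four,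
    hb0, Nat.choose_eq_zero_of_lt (show 1 < p - 1 by omega)] at hc
  simp at hc
  exact hc

omit [CharP K p] in
/-- **The kid's state is `G₂`** (already clean). [cite: HauserPerlega2019PRIMS, §2 (cleaning)] -/
theorem step_U2_hcert [DecidableEq K] (hp3 : 3 ≤ p) (s : State K)
    (hs : s.F = C 1 * (X 0 ^ 0 * X 1 ^ (p - 1) * X 2 ^ 1 * X 3 ^ 1) + C 1 * (X 0 ^ (p - 1) * X 1 ^ 1 * X 2 ^ 0 * X 3 ^ 0) +
        C 1 * (X 0 ^ 1 * X 1 ^ (p + 1) * X 2 ^ 0 * X 3 ^ 0)) :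
    (CentreBlowup.step p ({0, 1, 2} : Finset (Fin 4)) 2 (0 : Fin 4 → K) s).F =
      C 1 * (X 0 ^ 0 * X 1 ^ (p - 1) * X 2 ^ 0 * X 3 ^ 1) + C 1 * (X 0 ^ (p - 1) * X 1 ^ 1 * X 2 ^ 0 * X 3 ^ 0) +
        C 1 * (X 0 ^ 1 * X 1 ^ (p + 1) * X 2 ^ 2 * X 3 ^ 0) := by
  show deletePthPowers p (PointBlowup.translate (0 : Fin 4 → K)
    (CentreBlowup.chartTransform p ({0, 1, 2} : Finset (Fin 4)) 2 s.F)) = _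
  rw [hs, chartTransform_U2_hcert, PointBlowup.translate_zero]
  exact Literature.Barriers.ResolutionOfSingularities.HauserPerlega.deletePthPowers_eq_self (isClean_G2_hcert hp3)

/-! ## §4 The kid's charts are dead -/

omit [CharP K p] in
/-- **Kid chart `w₁` is DEAD**: `∂₄ H₀ = t₂^{p−1}` and `∂₂ H₀ = 1 + …`. [cite: Hauser2010, §F (equiconstant points)] -/
theorem not_isEquimultiplePoint_V0_hcert [DecidableEq K] (hp3 : 3 ≤ p) {b : Fin 4 → K} (s : State K)
    (hs : s.F = C 1 * (X 0 ^ 0 * X 1 ^ (p - 1) * X 2 ^ 0 * X 3 ^ 1) + C 1 * (X 0 ^ (p - 1) * X 1 ^ 1 * X 2 ^ 0 * X 3 ^ 0) +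
        C 1 * (X 0 ^ 1 * X 1 ^ (p + 1) * X 2 ^ 2 * X 3 ^ 0)) (hb : b 0 = 0) :
    ¬ CentreBlowup.IsEquimultiplePoint p ({0, 1, 3} : Finset (Fin 4)) 0 b s := by
  have hp0 : p ≠ 0 := hp.out.ne_zero
  intro h
  unfold CentreBlowup.IsEquimultiplePoint CentreBlowup.pointTransform at h
  rw [hs, chartTransform_V0_hcert] at h
  have h1 := eval_pderiv_eq_zero_of_forall_coeff b _ h 1
  have h3 := eval_pderiv_eq_zero_of_forall_coeff b _ h 3
  simp [(pderiv (1 : Fin 4)).leibniz_pow, (pderiv (3 : Fin 4)).leibniz_pow, hb] at h1 h3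
  rw [h3.1, zero_pow (by omega), mul_zero, mul_zero, zero_add] at h1
  exact one_ne_zero h1

omit [CharP K p] in
/-- **Kid chart `w₂` is DEAD**: `∂₄ H₁ = 1`. [cite: Hauser2010, §F (equiconstant points)] -/
theorem not_isEquimultiplePoint_V1_hcert [DecidableEq K] {b : Fin 4 → K} (s : State K)
    (hs : s.F = C 1 * (X 0 ^ 0 * X 1 ^ (p - 1) * X 2 ^ 0 * X 3 ^ 1) + C 1 * (X 0 ^ (p - 1) * X 1 ^ 1 * X 2 ^ 0 * X 3 ^ 0) +
        C 1 * (X 0 ^ 1 * X 1 ^ (p + 1) * X 2 ^ 2 * X 3 ^ 0)) :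
    ¬ CentreBlowup.IsEquimultiplePoint p ({0, 1, 3} : Finset (Fin 4)) 1 b s := by
  intro h
  unfold CentreBlowup.IsEquimultiplePoint CentreBlowup.pointTransform at h
  rw [hs, chartTransform_V1_hcert] at h
  have h3 := eval_pderiv_eq_zero_of_forall_coeff b _ h 3
  simp [(pderiv (3 : Fin 4)).leibniz_pow] at h3

omit [CharP K p] in
/-- **Kid chart `w₄` is DEAD**: the coefficient of `t₂^{p−1}` is `1` (`b₄ = 0` on the divisor). [cite: Hauser2010, §F (equiconstant points)] -/
theorem not_isEquimultiplePoint_V3_hcert [DecidableEq K] (hp3 : 3 ≤ p) {b : Fin 4 → K} (s : State K)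
    (hs : s.F = C 1 * (X 0 ^ 0 * X 1 ^ (p - 1) * X 2 ^ 0 * X 3 ^ 1) + C 1 * (X 0 ^ (p - 1) * X 1 ^ 1 * X 2 ^ 0 * X 3 ^ 0) +
        C 1 * (X 0 ^ 1 * X 1 ^ (p + 1) * X 2 ^ 2 * X 3 ^ 0)) (hb : b 3 = 0) :
    ¬ CentreBlowup.IsEquimultiplePoint p ({0, 1, 3} : Finset (Fin 4)) 3 b s := by
  intro h
  unfold CentreBlowup.IsEquimultiplePoint CentreBlowup.pointTransform at h
  rw [hs, chartTransform_V3_hcert] at h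
  have hc := h (Finsupp.single 0 0 + Finsupp.single 1 (p - 1) + Finsupp.single 2 0 + Finsupp.single 3 0)
    (fun he => by have := DFunLike.congr_fun he 1; simp at this; omega) (by rw [Rescue.BedSlopeResidual.degree_E4]; omega)
  rw [Rescue.BedMohRiseQ4TopLocus.translate_add, Rescue.BedMohRiseQ4TopLocus.translate_add, coeff_add, coeff_add, coeff_translate_four, coeff_translate_four, coeff_translate_four,
    hb, Nat.choose_eq_zero_of_lt (show 1 < p - 1 by omega)] at hc
  simp at hc

end HCertCharts

end Equimultiple

end Summit.ResolutionOfSingularities.ResolutionOfSingularities.Theorems.PIDim4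

end
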